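import Summits.CriticalPhenomena.PercolationContinuityZ3.Theorems.FK.EdgeCountCLTVariance
import Summits.CriticalPhenomena.PercolationContinuityZ3.Theorems.FK.WeakMixingPlanarSupercritical
import HarnessLib

/-!
# CENTRAL LIMIT THEOREM FOR THE OPEN-EDGE COUNT OF THE PLANAR RANDOM-CLUSTER MEASURE `φ^b_{p,q}` ON `ℤ²`
# AT EVERY `p ≠ p_sd(q) = √q/(1+√q)`, `q ≥ 1` — INCLUDING THE WHOLE SUPERCRITICAL PHASE

Claimed R42 (8)(c) in the cell INBOX at 2026-08-28T13:56:48Z by fkp-10a gen 354 (NEW CLAIM #2 of the gen), addressed to coordinator fk-4 g274 (seated 13:10Z 2026-08-28 by l.8389; R151 l.8390: row FO-10a-g354 [g274, R151] = package g354-newmanclt, its (κ) SPENT by l.8399 — hence a new ruling); lineage row FO-10a-g354x (self-suggested), package g354-cltextras, label PV-B.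
Helper file of the `fk-continuity` build cell (bschramm lane; `--supports stmt-CriticalPhenomena-4575`); builds on
p205010 (kernel theorem, internal audit signed; external expert review pending). No definitions, no named facts, no
sorries; standard axioms. UNCONDITIONAL.

On `ℤ²` the random-cluster measure is exponentially weakly mixing at every `p ≠ p_sd(q)` (tree:
`exists_exp_weakMixing_two_of_ne_selfDual`, Alexander 1998 Remark 3.5 via planar duality, Grimmett Thm. (6.17)(b) and
`p_c(q) = p_sd(q)`), hence the edge–edge covariances of `φ^b_{p,q}` decay exponentially ALSO ABOVE `p_c`
(`exists_exp_edgeCov_two_of_ne_selfDual`: `|Cov(1_{e_{0,i}}, 1_{e_{z,j}})| ≤ 4e^{5c}e^{−c‖z‖_∞}`), the susceptibility of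
the coordinate-edge field `X_z = Σ_{i<2} 1{⟨z, z+e_i⟩ open}` is finite (`summable_covariance_coordEdgeCount_two`), and
Newman's theorem (`NewmanCLT.tendstoInDistribution_boxSum`, with (C) = `isPositivelyAssociated_rcLimit` and (B) =
`covariance_coordEdgeCount_eq`) gives the CLT for the number `S_n` of open edges based in `Λ_n = [-n,n]²`:

* `tendsto_charFun_coordEdgeCount_two`, `tendstoInDistribution_coordEdgeCount_two` —
  `(S_n − E S_n)/√|Λ_n| → N(0, σ²)` under `φ^b_{p,q}`, `σ² = Σ_{z∈ℤ²} Cov_{φ^b}(X_0, X_z)`, for all `q ≥ 1`,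
  `p ∈ [0,1] ∖ {√q/(1+√q)}`, both `b` (for `p < p_sd` this is the `d = 2` case of `FKEdgeCountCLT`, for `p > p_sd` it is
  new: Gaussian energy fluctuations in the ordered phase of the planar Potts / random-cluster model);
* `tsum_covariance_coordEdgeCount_two_pos` — the limiting variance is positive for `0 < p < 1`, `p ≠ p_sd(q)`
  (`σ² ≥ 2·p(1−p)/(p+q(1−p))`, companion file `EdgeCountCLTVariance`).

## References

* C. M. Newman, *Normal fluctuations and the FKG inequalities*, Comm. Math. Phys. 74 (1980) 119–128, Thm. 2.
  [Newman1980]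
* K. S. Alexander, *On weak mixing in lattice models*, PTRF 110 (1998) 441–471, (1.1), Remark 3.5. [Alexander1998]
* G. Grimmett, *The Random-Cluster Model*, Springer 2006, Thm. (4.17)(b), (4.19)(b), Thm. (6.17). [Grimmett2006]
* V. Beffara, H. Duminil-Copin, PTRF 153 (2012) (`p_c = p_sd` on `ℤ²`). [BeffaraDuminilCopin2012]
-/

noncomputable section

namespace Summit.CriticalPhenomena.PercolationContinuityZ3.Theorems.FK

namespace NewmanCLT

open MeasureTheory ProbabilityTheory Complex Finset Filter Topology
open Literature.Probability.Percolation Literature.Probability.LatticeModels Literature.Barriers.CriticalPhenomena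
open BoundaryInfluence

variable {p q : ℝ}

/-! ### Edge–edge covariance decay on `ℤ²` at every `p ≠ p_sd` -/

/-- **Exponential decay of the edge–edge covariance of the planar random-cluster measure at every `p ≠ p_sd(q)`**:
for `q ≥ 1`, `p ∈ [0,1]`, `p ≠ √q/(1+√q)` there is `c > 0` with
`|φ^b(e_{0,i}, e_{z,j} open) − φ^b(e_{0,i})φ^b(e_{z,j})| ≤ 4e^{5c}·e^{−c‖z‖_∞}` for both `b`, all `z ∈ ℤ²`, `i, j`
(weak mixing with `k = 1`, `n = ‖z‖_∞ − 1` when `‖z‖_∞ ≥ 6`, the trivial bound `1` otherwise).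
[cite: Alexander1998, (1.1) and Remark 3.5; Grimmett2006, §2.5 (2.45), Thm. (6.17)] -/
theorem exists_exp_edgeCov_two_of_ne_selfDual (hq : 1 ≤ q) (hp : p ∈ Set.Icc (0 : ℝ) 1)
    (hne : p ≠ Real.sqrt q / (1 + Real.sqrt q)) :
    ∃ c : ℝ, 0 < c ∧ ∀ (b : Bool) (z : Site 2) (i j : Fin 2),
      |(rcLimit 2 b p q).real ({ω | s((0 : Site 2), 0 + Pi.single i 1) ∈ ω} ∩ {ω | s(z, z + Pi.single j 1) ∈ ω}) -
          (rcLimit 2 b p q).real {ω | s((0 : Site 2), 0 + Pi.single i 1) ∈ ω} *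
            (rcLimit 2 b p q).real {ω | s(z, z + Pi.single j 1) ∈ ω}| ≤
        4 * Real.exp (5 * c) * Real.exp (-(c * siteRad z)) := by
  obtain ⟨c, hc, h⟩ := exists_exp_weakMixing_two_of_ne_selfDual hq hp hne
  refine ⟨c, hc, fun b z i j => ?_⟩
  set P : Measure (BondConfig (Site 2)) := rcLimit 2 b p q with hPdef
  haveI := isProbabilityMeasure_rcLimit (d := 2) b p q
  have hdet : ∀ e : Sym2 (Site 2), DeterminedBy {ω : BondConfig (Site 2) | e ∈ ω} ↑({e} : Finset (Sym2 (Site 2))) := by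
    intro e; rw [determinedBy_iff]; intro ω₁ ω₂ hω
    have := Set.ext_iff.1 hω e
    simp only [Set.mem_inter_iff, Finset.coe_singleton, Set.mem_singleton_iff, and_true] at this
    exact this
  -- trivial bound
  have htriv : |P.real ({ω : BondConfig (Site 2) | s((0 : Site 2), 0 + Pi.single i 1) ∈ ω} ∩ {ω | s(z, z + Pi.single j 1) ∈ ω}) -
      P.real {ω : BondConfig (Site 2) | s((0 : Site 2), 0 + Pi.single i 1) ∈ ω} *
        P.real {ω : BondConfig (Site 2) | s(z, z + Pi.single j 1) ∈ ω}| ≤ 1 := by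
    have h1 : P.real ({ω : BondConfig (Site 2) | s((0 : Site 2), 0 + Pi.single i 1) ∈ ω} ∩ {ω | s(z, z + Pi.single j 1) ∈ ω}) ≤ 1 :=
      measureReal_le_one
    have h2 : P.real {ω : BondConfig (Site 2) | s((0 : Site 2), 0 + Pi.single i 1) ∈ ω} ≤ 1 := measureReal_le_one
    have h3 : P.real {ω : BondConfig (Site 2) | s(z, z + Pi.single j 1) ∈ ω} ≤ 1 := measureReal_le_one
    have h4 : 0 ≤ P.real ({ω : BondConfig (Site 2) | s((0 : Site 2), 0 + Pi.single i 1) ∈ ω} ∩ {ω | s(z, z + Pi.single j 1) ∈ ω}) :=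
      measureReal_nonneg
    have h5 : 0 ≤ P.real {ω : BondConfig (Site 2) | s((0 : Site 2), 0 + Pi.single i 1) ∈ ω} := measureReal_nonneg
    have h6 : 0 ≤ P.real {ω : BondConfig (Site 2) | s(z, z + Pi.single j 1) ∈ ω} := measureReal_nonneg
    rw [abs_le]; constructor <;> nlinarith
  by_cases hm : siteRad z ≤ 5
  · refine htriv.trans ?_
    rw [mul_assoc, ← Real.exp_add]
    have : 0 ≤ 5 * c + -(c * siteRad z) := by
      have : (siteRad z : ℝ) ≤ 5 := by exact_mod_cast hm
      nlinarith
    calc (1 : ℝ) ≤ 4 * 1 := by norm_num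
      _ ≤ 4 * Real.exp (5 * c + -(c * ↑(siteRad z))) :=
          mul_le_mul_of_nonneg_left (Real.one_le_exp this) (by norm_num)
  · rw [not_le] at hm
    have hF : ({s((0 : Site 2), (0 : Site 2) + Pi.single i 1)} : Finset (Sym2 (Site 2))) ⊆ edgesIn (zdGraph 2) (box 2 1) :=
      Finset.singleton_subset_iff.2 (coordEdge_zero_mem_edgesIn_box_one i)
    have hn : s(z, z + Pi.single j 1) ∉ edgesIn (zdGraph 2) (box 2 (siteRad z - 1)) :=
      coordEdge_notMem_edgesIn_box (by omega) j
    have hT : Disjoint (↑({s(z, z + Pi.single j 1)} : Finset (Sym2 (Site 2))) : Set (Sym2 (Site 2)))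
        ↑(edgesIn (zdGraph 2) (box 2 (siteRad z - 1))) := by
      rw [Finset.coe_singleton, Set.disjoint_singleton_left, Finset.mem_coe]; exact hn
    have key := h b (show 1 + 3 < siteRad z - 1 by omega) hF (hdet _)
      ({s(z, z + Pi.single j 1)} : Finset (Sym2 (Site 2))) hT (hdet _)
    rw [Finset.card_singleton, Nat.cast_one, mul_one] at key
    refine key.trans ?_
    have h1 : P.real {ω : BondConfig (Site 2) | s(z, z + Pi.single j 1) ∈ ω} ≤ 1 := measureReal_le_one
    have h2 : 0 ≤ Real.exp (-(c * (((siteRad z - 1 : ℕ) : ℝ) - 1 - 3))) := (Real.exp_pos _).le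
    have h3 : Real.exp (-(c * (((siteRad z - 1 : ℕ) : ℝ) - 1 - 3))) = Real.exp (5 * c) * Real.exp (-(c * siteRad z)) := by
      rw [← Real.exp_add, Nat.cast_sub (by omega), Nat.cast_one]; congr 1; ring
    calc 4 * P.real {ω : BondConfig (Site 2) | s(z, z + Pi.single j 1) ∈ ω} * Real.exp (-(c * (((siteRad z - 1 : ℕ) : ℝ) - 1 - 3)))
        ≤ 4 * 1 * Real.exp (-(c * (((siteRad z - 1 : ℕ) : ℝ) - 1 - 3))) := by gcongr
      _ = 4 * Real.exp (5 * c) * Real.exp (-(c * siteRad z)) := by rw [h3]; ring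

/-- **Covariance decay of the planar coordinate-edge counts at every `p ≠ p_sd(q)`**:
`|Cov_{φ^b}(X_0, X_z)| ≤ 16e^{5c}·e^{−c‖z‖_∞}` (`d = 2`). [cite: Alexander1998, (1.1) and Remark 3.5; Grimmett2006, §2.5 (2.45)] -/
theorem exists_abs_covariance_coordEdgeCount_two_le (hq : 1 ≤ q) (hp : p ∈ Set.Icc (0 : ℝ) 1)
    (hne : p ≠ Real.sqrt q / (1 + Real.sqrt q)) :
    ∃ c : ℝ, 0 < c ∧ ∀ (b : Bool) (z : Site 2),
      |cov[fun ω => ∑ i : Fin 2, ({ω' : BondConfig (Site 2) | s((0 : Site 2), 0 + Pi.single i 1) ∈ ω'}).indicator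
          (1 : BondConfig (Site 2) → ℝ) ω,
        fun ω => ∑ j : Fin 2, ({ω' : BondConfig (Site 2) | s(z, z + Pi.single j 1) ∈ ω'}).indicator
          (1 : BondConfig (Site 2) → ℝ) ω; rcLimit 2 b p q]| ≤
        4 * (2 : ℝ) ^ 2 * Real.exp (5 * c) * Real.exp (-(c * siteRad z)) := by
  obtain ⟨c, hc, h⟩ := exists_exp_edgeCov_two_of_ne_selfDual hq hp hne
  refine ⟨c, hc, fun b z => ?_⟩
  haveI := isProbabilityMeasure_rcLimit (d := 2) b p q
  have hm : ∀ (w : Site 2) (i : Fin 2), MemLp (({ω' : BondConfig (Site 2) | s(w, w + Pi.single i 1) ∈ ω'}).indicator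
      (1 : BondConfig (Site 2) → ℝ)) 2 (rcLimit 2 b p q) := fun w i =>
    memLp_of_abs_le (measurable_indicator_coordEdge w i) (fun ω => abs_indicator_one_le_one _ ω) 2
  rw [covariance_fun_sum_fun_sum' (fun i _ => hm 0 i) (fun j _ => hm z j)]
  refine (Finset.abs_sum_le_sum_abs _ _).trans ?_
  refine (Finset.sum_le_sum fun i _ => Finset.abs_sum_le_sum_abs _ _).trans ?_
  have hterm : ∀ i j : Fin 2, |cov[({ω' : BondConfig (Site 2) | s((0 : Site 2), 0 + Pi.single i 1) ∈ ω'}).indicator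
      (1 : BondConfig (Site 2) → ℝ), ({ω' : BondConfig (Site 2) | s(z, z + Pi.single j 1) ∈ ω'}).indicator
      (1 : BondConfig (Site 2) → ℝ); rcLimit 2 b p q]| ≤ 4 * Real.exp (5 * c) * Real.exp (-(c * siteRad z)) := by
    intro i j
    rw [covariance_indicator_one_eq _ (measurableSet_of_isLocalEvent_holds (isLocalEvent_setOf_mem _))
      (measurableSet_of_isLocalEvent_holds (isLocalEvent_setOf_mem _))]
    exact h b z i j
  calc _ ≤ ∑ _i : Fin 2, ∑ _j : Fin 2, 4 * Real.exp (5 * c) * Real.exp (-(c * siteRad z)) :=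
        Finset.sum_le_sum fun i _ => Finset.sum_le_sum fun j _ => hterm i j
    _ = 4 * (2 : ℝ) ^ 2 * Real.exp (5 * c) * Real.exp (-(c * siteRad z)) := by
        rw [Finset.sum_const, Finset.sum_const, Finset.card_univ, Fintype.card_fin, nsmul_eq_mul, nsmul_eq_mul]; ring

/-- **Finite susceptibility of the planar edge field at every `p ≠ p_sd(q)`**: `z ↦ Cov_{φ^b}(X_0, X_z)` is summable over
`ℤ²`. [cite: Newman1980, Thm. 2 (D); Alexander1998, Remark 3.5] -/
theorem summable_covariance_coordEdgeCount_two (hq : 1 ≤ q) (hp : p ∈ Set.Icc (0 : ℝ) 1)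
    (hne : p ≠ Real.sqrt q / (1 + Real.sqrt q)) (b : Bool) :
    Summable fun z : Site 2 => cov[fun ω => ∑ i : Fin 2,
        ({ω' : BondConfig (Site 2) | s((0 : Site 2), 0 + Pi.single i 1) ∈ ω'}).indicator (1 : BondConfig (Site 2) → ℝ) ω,
      fun ω => ∑ j : Fin 2, ({ω' : BondConfig (Site 2) | s(z, z + Pi.single j 1) ∈ ω'}).indicator
        (1 : BondConfig (Site 2) → ℝ) ω; rcLimit 2 b p q] := by
  obtain ⟨c, hc, h⟩ := exists_abs_covariance_coordEdgeCount_two_le hq hp hne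
  refine Summable.of_norm_bounded ((summable_exp_neg_mul_siteRad (d := 2) hc).mul_left
    (4 * (2 : ℝ) ^ 2 * Real.exp (5 * c))) fun z => ?_
  rw [Real.norm_eq_abs]
  exact h b z

/-! ### The central limit theorem on `ℤ²` off the self-dual point -/

/-- **CLT for the planar open-edge count at every `p ≠ p_sd(q)`, characteristic-function form**: for `q ≥ 1`,
`p ∈ [0,1]`, `p ≠ √q/(1+√q)`, both `b`, every real `t`: `E_{φ^b} exp(it(S_n − E S_n)/√|Λ_n|) → exp(−σ²t²/2)`,
`S_n = Σ_{z∈Λ_n} Σ_{i<2} 1{⟨z, z+e_i⟩ open}`, `σ² = Σ_z Cov_{φ^b}(X_0, X_z)`. [cite: Newman1980, Thm. 2; Alexander1998, Remark 3.5; Grimmett2006, Thm. (6.17)] -/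
theorem tendsto_charFun_coordEdgeCount_two (hq : 1 ≤ q) (hp : p ∈ Set.Icc (0 : ℝ) 1)
    (hne : p ≠ Real.sqrt q / (1 + Real.sqrt q)) (b : Bool) (t : ℝ) :
    Tendsto (fun n : ℕ => ∫ ω, cexp ((((t / Real.sqrt #(box 2 n)) *
        (∑ z ∈ box 2 n, ∑ i : Fin 2, ({ω' : BondConfig (Site 2) | s(z, z + Pi.single i 1) ∈ ω'}).indicator
            (1 : BondConfig (Site 2) → ℝ) ω -
          ∫ ω', ∑ z ∈ box 2 n, ∑ i : Fin 2, ({ω'' : BondConfig (Site 2) | s(z, z + Pi.single i 1) ∈ ω''}).indicator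
            (1 : BondConfig (Site 2) → ℝ) ω' ∂(rcLimit 2 b p q)) : ℝ) : ℂ) * I) ∂(rcLimit 2 b p q))
      atTop (𝓝 ((Real.exp (-((∑' z : Site 2, cov[fun ω => ∑ i : Fin 2,
        ({ω' : BondConfig (Site 2) | s((0 : Site 2), 0 + Pi.single i 1) ∈ ω'}).indicator (1 : BondConfig (Site 2) → ℝ) ω,
        fun ω => ∑ j : Fin 2, ({ω' : BondConfig (Site 2) | s(z, z + Pi.single j 1) ∈ ω'}).indicator
          (1 : BondConfig (Site 2) → ℝ) ω; rcLimit 2 b p q]) * t ^ 2 / 2)) : ℝ) : ℂ)) := by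
  haveI := isProbabilityMeasure_rcLimit (d := 2) b p q
  have hμ : IsPositivelyAssociated (rcLimit 2 b p q) := isPositivelyAssociated_rcLimit b hp hq
  have hcov : ∀ x y : Site 2, cov[(fun (z : Site 2) (ω : BondConfig (Site 2)) => ∑ i : Fin 2,
        ({ω' : BondConfig (Site 2) | s(z, z + Pi.single i 1) ∈ ω'}).indicator (1 : BondConfig (Site 2) → ℝ) ω) x,
      (fun (z : Site 2) (ω : BondConfig (Site 2)) => ∑ i : Fin 2,
        ({ω' : BondConfig (Site 2) | s(z, z + Pi.single i 1) ∈ ω'}).indicator (1 : BondConfig (Site 2) → ℝ) ω) y;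
        rcLimit 2 b p q] =
      (fun (z : Site 2) => cov[fun ω => ∑ i : Fin 2,
        ({ω' : BondConfig (Site 2) | s((0 : Site 2), 0 + Pi.single i 1) ∈ ω'}).indicator (1 : BondConfig (Site 2) → ℝ) ω,
        fun ω => ∑ j : Fin 2, ({ω' : BondConfig (Site 2) | s(z, z + Pi.single j 1) ∈ ω'}).indicator
          (1 : BondConfig (Site 2) → ℝ) ω; rcLimit 2 b p q]) (y - x) :=
    fun x y => covariance_coordEdgeCount_eq b hp hq x y
  have hs : Summable (fun (z : Site 2) => cov[fun ω => ∑ i : Fin 2,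
        ({ω' : BondConfig (Site 2) | s((0 : Site 2), 0 + Pi.single i 1) ∈ ω'}).indicator (1 : BondConfig (Site 2) → ℝ) ω,
        fun ω => ∑ j : Fin 2, ({ω' : BondConfig (Site 2) | s(z, z + Pi.single j 1) ∈ ω'}).indicator
          (1 : BondConfig (Site 2) → ℝ) ω; rcLimit 2 b p q]) :=
    summable_covariance_coordEdgeCount_two hq hp hne b
  exact tendsto_charFun_boxSum (le_refl 1 |>.trans one_le_two) hμ measurable_coordEdgeCount monotone_coordEdgeCount
    (Nat.cast_nonneg 2) abs_coordEdgeCount_le hcov hs t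

/-- **CENTRAL LIMIT THEOREM FOR THE OPEN-EDGE COUNT OF THE PLANAR RANDOM-CLUSTER MEASURE AT EVERY `p ≠ p_sd(q)`**
(both phases): for `q ≥ 1`, `p ∈ [0,1] ∖ {√q/(1+√q)}`, both `b`: `(S_n − E_{φ^b} S_n)/√|Λ_n| → N(0, σ²)` in distribution
under `φ^b_{p,q}` on `ℤ²`, `σ² = Σ_{z∈ℤ²} Cov_{φ^b}(X_0, X_z)`, for any `Y ~ gaussianReal 0 σ²`.
[cite: Newman1980, Thm. 2; Alexander1998, Remark 3.5; Grimmett2006, Thm. (4.17)(b), (4.19)(b), (6.17)] -/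
theorem tendstoInDistribution_coordEdgeCount_two {Ω' : Type*} {mΩ' : MeasurableSpace Ω'} {P' : Measure Ω'}
    [IsProbabilityMeasure P'] {Y : Ω' → ℝ} (hq : 1 ≤ q) (hp : p ∈ Set.Icc (0 : ℝ) 1)
    (hne : p ≠ Real.sqrt q / (1 + Real.sqrt q)) (b : Bool) {v : NNReal}
    (hv : (v : ℝ) = ∑' z : Site 2, cov[fun ω => ∑ i : Fin 2,
        ({ω' : BondConfig (Site 2) | s((0 : Site 2), 0 + Pi.single i 1) ∈ ω'}).indicator (1 : BondConfig (Site 2) → ℝ) ω,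
        fun ω => ∑ j : Fin 2, ({ω' : BondConfig (Site 2) | s(z, z + Pi.single j 1) ∈ ω'}).indicator
          (1 : BondConfig (Site 2) → ℝ) ω; rcLimit 2 b p q]) (hY : HasLaw Y (gaussianReal 0 v) P') :
    haveI := isProbabilityMeasure_rcLimit (d := 2) b p q
    TendstoInDistribution (fun (n : ℕ) (ω : BondConfig (Site 2)) => (Real.sqrt #(box 2 n))⁻¹ *
        (∑ z ∈ box 2 n, ∑ i : Fin 2, ({ω' : BondConfig (Site 2) | s(z, z + Pi.single i 1) ∈ ω'}).indicator
            (1 : BondConfig (Site 2) → ℝ) ω -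
          ∫ ω', ∑ z ∈ box 2 n, ∑ i : Fin 2, ({ω'' : BondConfig (Site 2) | s(z, z + Pi.single i 1) ∈ ω''}).indicator
            (1 : BondConfig (Site 2) → ℝ) ω' ∂(rcLimit 2 b p q)))
      atTop Y (fun _ => rcLimit 2 b p q) P' := by
  haveI := isProbabilityMeasure_rcLimit (d := 2) b p q
  have hμ : IsPositivelyAssociated (rcLimit 2 b p q) := isPositivelyAssociated_rcLimit b hp hq
  have hcov : ∀ x y : Site 2, cov[(fun (z : Site 2) (ω : BondConfig (Site 2)) => ∑ i : Fin 2,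
        ({ω' : BondConfig (Site 2) | s(z, z + Pi.single i 1) ∈ ω'}).indicator (1 : BondConfig (Site 2) → ℝ) ω) x,
      (fun (z : Site 2) (ω : BondConfig (Site 2)) => ∑ i : Fin 2,
        ({ω' : BondConfig (Site 2) | s(z, z + Pi.single i 1) ∈ ω'}).indicator (1 : BondConfig (Site 2) → ℝ) ω) y;
        rcLimit 2 b p q] =
      (fun (z : Site 2) => cov[fun ω => ∑ i : Fin 2,
        ({ω' : BondConfig (Site 2) | s((0 : Site 2), 0 + Pi.single i 1) ∈ ω'}).indicator (1 : BondConfig (Site 2) → ℝ) ω,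
        fun ω => ∑ j : Fin 2, ({ω' : BondConfig (Site 2) | s(z, z + Pi.single j 1) ∈ ω'}).indicator
          (1 : BondConfig (Site 2) → ℝ) ω; rcLimit 2 b p q]) (y - x) :=
    fun x y => covariance_coordEdgeCount_eq b hp hq x y
  have hs : Summable (fun (z : Site 2) => cov[fun ω => ∑ i : Fin 2,
        ({ω' : BondConfig (Site 2) | s((0 : Site 2), 0 + Pi.single i 1) ∈ ω'}).indicator (1 : BondConfig (Site 2) → ℝ) ω,
        fun ω => ∑ j : Fin 2, ({ω' : BondConfig (Site 2) | s(z, z + Pi.single j 1) ∈ ω'}).indicator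
          (1 : BondConfig (Site 2) → ℝ) ω; rcLimit 2 b p q]) :=
    summable_covariance_coordEdgeCount_two hq hp hne b
  exact tendstoInDistribution_boxSum (le_refl 1 |>.trans one_le_two) hμ measurable_coordEdgeCount
    monotone_coordEdgeCount (Nat.cast_nonneg 2) abs_coordEdgeCount_le hcov hs hv hY

/-- **The planar CLT is non-degenerate**: for `q ≥ 1`, `0 < p < 1`, `p ≠ √q/(1+√q)`, both `b`,
`σ² = Σ_{z∈ℤ²} Cov_{φ^b}(X_0, X_z) ≥ 2·p(1−p)/(p+q(1−p)) > 0`. [cite: Newman1980, (13); Grimmett2006, Thm. (4.17)(b)] -/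
theorem tsum_covariance_coordEdgeCount_two_pos (hq : 1 ≤ q) (hp0 : 0 < p) (hp1 : p < 1)
    (hne : p ≠ Real.sqrt q / (1 + Real.sqrt q)) (b : Bool) :
    0 < ∑' z : Site 2, cov[fun ω => ∑ i : Fin 2,
        ({ω' : BondConfig (Site 2) | s((0 : Site 2), 0 + Pi.single i 1) ∈ ω'}).indicator (1 : BondConfig (Site 2) → ℝ) ω,
        fun ω => ∑ j : Fin 2, ({ω' : BondConfig (Site 2) | s(z, z + Pi.single j 1) ∈ ω'}).indicator
          (1 : BondConfig (Site 2) → ℝ) ω; rcLimit 2 b p q] := by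
  have hp : p ∈ Set.Icc (0 : ℝ) 1 := ⟨hp0.le, hp1.le⟩
  refine lt_of_lt_of_le ?_ (tsum_covariance_coordEdgeCount_ge b hp hq (summable_covariance_coordEdgeCount_two hq hp hne b))
  have hden : 0 < p + q * (1 - p) := by nlinarith
  have hπ : 0 < p / (p + q * (1 - p)) := div_pos hp0 hden
  have h1p : 0 < 1 - p := by linarith
  have h2 : ((2 : ℕ) : ℝ) = 2 := by norm_num
  rw [h2]
  positivity

end NewmanCLT

end Summit.CriticalPhenomena.PercolationContinuityZ3.Theorems.FK
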